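import Summits.Ventures.HodgeRepro.Night4ReducedDimQuads

/-!
# Beyond the census faces, the complete tables: the right-twist reduction and the bridge from a double-class cover

Blind re-derivation cell `pub-hodge-repro`, seat `night-4` (ROUTE HARDENING for the Monday FINAL, gen 6).  Target tree
path `lean/Summits/Ventures/HodgeRepro/Night4ReducedDimQuadTable.lean`.

`Night4ReducedDimQuads.lean` (gen 5) gives the bridge from a Boolean table to EVERY conjugate-free `SumTwo` quadruple of
CM types of `(G, c)` — the exceptional `(2,2)`-classes of ROUTE.md v2.89 §3.1 / §3.4, census faces and the non-census
patterns `(3,2,1)`, `(2,2,2)` alike — with the base corner `T 0` running over the 32 CM types containing `1`; measured at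
≈ 20 s of kernel time per base corner, the six tables of degree 12 stayed «measured, not run» (≈ 11 min per `(G, c)`).
This file adds the THIRD reduction: `dim B_red` is invariant under a simultaneous RIGHT twist `T i ↦ T i · h` of all four
corners (`redDim_rmul` — a twist permutes each isogeny class and keeps `simpleDim`, so the first-representative formula
is unchanged), as it is under a Galois translate (`redDim_smul`) and a relabelling (`redDim_comp_perm`); so the base
corner may run over representatives of the DOUBLE classes `{g · Φ · h}` — 6 for `C12`, 8 for `C6 × C2`, 6 for `D6`, 4 for
`Dic3` instead of 32 — and one `(G, c)` of order 12 is 4–8 kernel rows of ≈ 20 s (`Night4ReducedDimQuadC12.lean`, …).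

* `SumTwo.rmul`, `ConjFree.rmul`, `sameClass_rmul_iff`, `sameClass_smul_iff`, `isFirst_rmul_iff`, `redDimFirst_rmul`,
  **`redDim_rmul`**;
* `DegSixShape T` — the shape of the degree-6 faces (§3.2 «three translates of one type + one lift»): all six pairwise
  intersections of the corners have two embeddings (pattern `(2,2,2)`) and three corners are right translates of one type
  while the fourth is lifted from a subfield of degree ≤ 4 (`simpleDim ≤ 2`); decidable; invariant under twists, Galois
  translates and relabellings (`degSixShape_rmul_iff` / `_smul_iff` / `_comp_perm_iff`);
* `night4QuadPred vals T` — the table predicate: `redDimFirst T ∈ vals`, and `DegSixShape T` whenever `redDimFirst T < 9`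
  (below the census minimum of degree 12, ROUTE.md §3.4);
* `quadCheckP` / `quadRow` / `quadTableP` — the Boolean table, one row per base corner (`T₁` over all CM types, `T₂` over
  the `2^{|T₀ \ T₁|}` third corners compatible with `SumTwo`, `T₃` forced), the check gated by the key order of corners
  1, 2, 3 and by `Intersecting`;
* `mem_types_of_cover` (every CM type is in `types1 ++ types1.map (c • ·)` once `types1` holds every type containing `1`),
  `bases_cover_of_all` (the double-class cover from one Boolean check over the CM types);
* **`exists_normalForm_of_quadTableP`** — the bridge: from the table, every conjugate-free `SumTwo` quadruple `T` has a
  normal form `i ↦ (g · T (σ i)) · h` (base corner in `bases`, keys of corners 1, 2, 3 sorted) on which the predicate holds;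
  **`night4Quad_of_table`** — with `night4QuadPred`: `redDim T ∈ vals ∧ (redDim T < 9 → DegSixShape T)` for every such `T`.

Nothing here says anything about the status of the Hodge conjecture for CM abelian varieties, which is NOT proved.
-/

set_option autoImplicit false

open Finset
open scoped Pointwise

namespace HodgeRepro

/-! ## The right twist of all four corners -/

section Twist

variable {G : Type} [Group G] [DecidableEq G]

/-- A right twist of all four corners keeps `SumTwo`. -/
theorem SumTwo.rmul {T : Fin 4 → Finset G} (h : G) (hT : SumTwo T) :
    SumTwo (fun i => HodgeRepro.rmul (T i) h) := by
  intro x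
  have e : (univ.filter fun i => x ∈ HodgeRepro.rmul (T i) h) = univ.filter fun i => x * h⁻¹ ∈ T i :=
    Finset.filter_congr fun i _ => mem_rmul
  rw [e]
  exact hT _

/-- A right twist of all four corners keeps conjugate-freeness. -/
theorem ConjFree.rmul {c : G} {T : Fin 4 → Finset G} (h : G) (hT : ConjFree c T) :
    ConjFree c (fun i => HodgeRepro.rmul (T i) h) := by
  intro i j hij e
  rw [smul_rmul] at e
  exact hT i j hij (rmul_injective h e)

omit [DecidableEq G] in
/-- Two twists are in the same isogeny class iff the types are. -/
theorem sameClass_rmul_iff (S T : Finset G) (h : G) : SameClass (rmul S h) (rmul T h) ↔ SameClass S T := by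
  constructor
  · rintro ⟨k, e⟩
    refine ⟨h * k * h⁻¹, ?_⟩
    have e' := congrArg (fun X => rmul X h⁻¹) e
    simp only [rmul_rmul] at e'
    rwa [mul_inv_cancel, rmul_one] at e'
  · rintro ⟨k, rfl⟩
    refine ⟨h⁻¹ * k * h, ?_⟩
    rw [rmul_rmul, rmul_rmul]
    congr 1
    group

/-- Two Galois translates are in the same isogeny class iff the types are. -/
theorem sameClass_smul_iff (g : G) (S T : Finset G) : SameClass (g • S) (g • T) ↔ SameClass S T := by
  constructor
  · rintro ⟨k, e⟩
    refine ⟨k, ?_⟩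
    rw [← smul_rmul] at e
    exact MulAction.injective g e
  · rintro ⟨k, rfl⟩
    exact ⟨k, (smul_rmul g S k).symm⟩

omit [DecidableEq G] in
/-- The first representatives of the classes are the same after a twist. -/
theorem isFirst_rmul_iff (T : Fin 4 → Finset G) (h : G) (i : Fin 4) :
    IsFirst (fun j => rmul (T j) h) i ↔ IsFirst T i := by
  unfold IsFirst
  simp only [sameClass_rmul_iff]

variable [Fintype G]

/-- `redDimFirst` is invariant under a simultaneous right twist of the corners. -/
theorem redDimFirst_rmul (T : Fin 4 → Finset G) (h : G) :
    redDimFirst (fun i => rmul (T i) h) = redDimFirst T := by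
  unfold redDimFirst
  refine Finset.sum_congr rfl fun i _ => ?_
  by_cases hi : IsFirst T i
  · rw [if_pos hi, if_pos ((isFirst_rmul_iff T h i).2 hi), simpleDim_rmul]
  · rw [if_neg hi, if_neg fun h' => hi ((isFirst_rmul_iff T h i).1 h')]

/-- **`dim B_red` is invariant under a simultaneous right twist of the four corners** (the twist permutes each isogeny
class and keeps the simple dimensions). -/
theorem redDim_rmul (T : Fin 4 → Finset G) (h : G) : redDim (fun i => rmul (T i) h) = redDim T := by
  rw [redDim_eq_redDimFirst, redDim_eq_redDimFirst, redDimFirst_rmul]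

end Twist

/-! ## The degree-6 shape -/

section Shape

variable {G : Type} [Group G] [Fintype G] [DecidableEq G]

/-- **The shape of the degree-6 faces** (ROUTE.md §3.2: three translates of one type plus one lift): all six pairwise
intersections of the corners have two embeddings (pattern `(2,2,2)`), and three corners are right translates of one type
while the fourth is lifted from a CM subfield of degree ≤ 4 (`simpleDim ≤ 2`: an elliptic curve or a CM surface). -/
def DegSixShape (T : Fin 4 → Finset G) : Prop :=
  (∀ i j : Fin 4, i ≠ j → (T i ∩ T j).card = 2) ∧
    ∃ i : Fin 4, simpleDim (T i) ≤ 2 ∧ ∀ j k : Fin 4, j ≠ i → k ≠ i → SameClass (T j) (T k)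

/-- `DegSixShape` is decidable. -/
instance (T : Fin 4 → Finset G) : Decidable (DegSixShape T) := by
  unfold DegSixShape
  infer_instance

/-- The degree-6 shape is invariant under a simultaneous right twist. -/
theorem degSixShape_rmul_iff (T : Fin 4 → Finset G) (h : G) :
    DegSixShape (fun i => rmul (T i) h) ↔ DegSixShape T := by
  unfold DegSixShape
  simp only [← rmul_inter, card_rmul, simpleDim_rmul, sameClass_rmul_iff]

/-- The degree-6 shape is invariant under a Galois translate. -/
theorem degSixShape_smul_iff (g : G) (T : Fin 4 → Finset G) :
    DegSixShape (fun i => g • T i) ↔ DegSixShape T := by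
  unfold DegSixShape
  simp only [← Finset.smul_finset_inter, Finset.card_smul_finset, simpleDim_smul, sameClass_smul_iff]

/-- The degree-6 shape is invariant under a relabelling of the corners. -/
theorem degSixShape_comp_perm_iff (T : Fin 4 → Finset G) (σ : Equiv.Perm (Fin 4)) :
    DegSixShape (T ∘ σ) ↔ DegSixShape T := by
  unfold DegSixShape
  constructor
  · rintro ⟨h1, i, hi, h2⟩
    refine ⟨fun a b hab => ?_, σ i, hi, fun a b ha hb => ?_⟩
    · have := h1 (σ.symm a) (σ.symm b) fun e => hab (σ.symm.injective e)
      simpa only [Function.comp_apply, Equiv.apply_symm_apply] using this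
    · have := h2 (σ.symm a) (σ.symm b) (fun e => ha (by rw [← e, Equiv.apply_symm_apply]))
        (fun e => hb (by rw [← e, Equiv.apply_symm_apply]))
      simpa only [Function.comp_apply, Equiv.apply_symm_apply] using this
  · rintro ⟨h1, i, hi, h2⟩
    refine ⟨fun a b hab => h1 (σ a) (σ b) fun e => hab (σ.injective e), σ.symm i, ?_, fun a b ha hb => ?_⟩
    · simpa only [Function.comp_apply, Equiv.apply_symm_apply] using hi
    · exact h2 (σ a) (σ b) (fun e => ha (by rw [← e, Equiv.symm_apply_apply]))
        (fun e => hb (by rw [← e, Equiv.symm_apply_apply]))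

end Shape

/-! ## The table with a double-class cover of the base corner -/

section Table

variable {G : Type} [Group G] [Fintype G] [DecidableEq G]

/-- The table predicate of the degree-12 tables: `redDimFirst T ∈ vals`, and the degree-6 shape whenever `redDimFirst T < 9`
(below the census minimum of degree 12, ROUTE.md §3.4). -/
def night4QuadPred (vals : List ℕ) (T : Fin 4 → Finset G) : Bool :=
  decide (redDimFirst T ∈ vals ∧ (redDimFirst T < 9 → DegSixShape T))

/-- One candidate `(T₀, T₁, T₂)` with `T₃ := fourth T₀ T₁ T₂`: unless the keys of corners 1, 2, 3 are sorted and the four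
corners pairwise meet nothing is checked; otherwise the predicate `P` of the quadruple. -/
def quadCheckP (key : Finset G → ℕ) (P : (Fin 4 → Finset G) → Bool) (T₀ T₁ T₂ : Finset G) : Bool :=
  !decide (key T₁ ≤ key T₂ ∧ key T₂ ≤ key (fourth T₀ T₁ T₂) ∧ Intersecting ![T₀, T₁, T₂, fourth T₀ T₁ T₂]) ||
    P ![T₀, T₁, T₂, fourth T₀ T₁ T₂]

/-- The row of one base corner `T₀`: `T₁` over `types`, `T₂` over the `2^{|T₀ \ T₁|}` third corners
`c (T₀ ∩ T₁) ∪ S ∪ c ((T₀ \ T₁) \ S)` compatible with `SumTwo` (`SumTwo.two_eq`). -/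
def quadRow (c : G) (key : Finset G → ℕ) (P : (Fin 4 → Finset G) → Bool) (types : List (Finset G))
    (T₀ : Finset G) : Bool :=
  types.all fun T₁ =>
    msetAll (fun S => quadCheckP key P T₀ T₁ (c • (T₀ ∩ T₁) ∪ S ∪ c • ((T₀ \ T₁) \ S))) (T₀ \ T₁).powerset.val

/-- The table: one row per base corner of `bases`. -/
def quadTableP (c : G) (key : Finset G → ℕ) (P : (Fin 4 → Finset G) → Bool) (bases types : List (Finset G)) :
    Bool :=
  bases.all (quadRow c key P types)

/-- Every CM type is in `types1 ++ types1.map (c • ·)` once `types1` holds every CM type containing `1` (a CM type or its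
conjugate contains `1`). -/
theorem mem_types_of_cover {c : G} (hc : IsComplexConj c) (types1 : List (Finset G))
    (h1 : ∀ Φ : Finset G, IsCMType c Φ → (1 : G) ∈ Φ → Φ ∈ types1) (Φ : Finset G) (hΦ : IsCMType c Φ) :
    Φ ∈ types1 ++ types1.map (c • ·) := by
  rw [List.mem_append, List.mem_map]
  by_cases h : (1 : G) ∈ Φ
  · exact Or.inl (h1 Φ hΦ h)
  · refine Or.inr ⟨c • Φ, h1 _ (hΦ.conj hc) ?_, hc.smul_smul_finset Φ⟩
    rw [hc.mem_smul_iff]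
    exact (hΦ.mem_or_conj_mem 1).resolve_left h

/-- The double-class cover of the base corner from one Boolean check over a list holding every CM type. -/
theorem bases_cover_of_all {c : G} (bases types : List (Finset G)) (hall : ∀ Φ : Finset G, IsCMType c Φ → Φ ∈ types)
    (h : (types.all fun Φ => decide (∃ g h : G, rmul (g • Φ) h ∈ bases)) = true) :
    ∀ Φ : Finset G, IsCMType c Φ → ∃ g h : G, rmul (g • Φ) h ∈ bases := by
  intro Φ hΦ
  simp only [List.all_eq_true, decide_eq_true_eq] at h
  exact h Φ (hall Φ hΦ)

/-- **The bridge from the table to every conjugate-free `SumTwo` quadruple.**  `bases` holds a representative of the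
double class `{g · Φ · h}` of every CM type and `types` every CM type.  Then every conjugate-free `SumTwo` quadruple `T`
of CM types has a normal form `i ↦ (g · T (σ i)) · h` — base corner in `bases`, keys of corners 1, 2, 3 sorted — on which
the predicate `P` holds: twist and translate so that the base corner is a representative, relabel by
`exists_perm_key_sorted`, the third corner is one of the enumerated ones (`SumTwo.two_eq`), the fourth is forced
(`SumTwo.three_eq_fourth`), and the corners pairwise meet (`ConjFree.intersecting`). -/
theorem exists_normalForm_of_quadTableP {c : G} (hc : IsComplexConj c) (bases types : List (Finset G))
    (hb : ∀ Φ : Finset G, IsCMType c Φ → ∃ g h : G, rmul (g • Φ) h ∈ bases)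
    (hall : ∀ Φ : Finset G, IsCMType c Φ → Φ ∈ types) (key : Finset G → ℕ) (P : (Fin 4 → Finset G) → Bool)
    (htab : quadTableP c key P bases types = true)
    (T : Fin 4 → Finset G) (hT : ∀ i, IsCMType c (T i)) (hsum : SumTwo T) (hconj : ConjFree c T) :
    ∃ (g h : G) (σ : Equiv.Perm (Fin 4)), P (fun i => rmul (g • T (σ i)) h) = true := by
  unfold quadTableP at htab
  simp only [List.all_eq_true] at htab
  obtain ⟨g, h, hgh⟩ := hb (T 0) (hT 0)
  -- twist and translate so that the base corner is a representative
  set T' : Fin 4 → Finset G := fun i => rmul (g • T i) h with hT'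
  have hT'cm : ∀ i, IsCMType c (T' i) := fun i => ((hT i).smul hc g).rmul h
  have hsum' : SumTwo T' := (hsum.smul g).rmul h
  have hconj' : ConjFree c T' := (hconj.smul hc g).rmul h
  -- relabel so that the keys of corners 1, 2, 3 are sorted
  obtain ⟨σ, hσ0, hk12, hk23⟩ := exists_perm_key_sorted key T'
  refine ⟨g, h, σ, ?_⟩
  have hUcm : ∀ i, IsCMType c ((T' ∘ σ) i) := fun i => hT'cm (σ i)
  have hUsum : SumTwo (T' ∘ σ) := hsum'.comp_perm σ
  have hUconj : ConjFree c (T' ∘ σ) := hconj'.comp_perm σ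
  have hU3 : (T' ∘ σ) 3 = fourth ((T' ∘ σ) 0) ((T' ∘ σ) 1) ((T' ∘ σ) 2) := hUsum.three_eq_fourth
  have hUeq : T' ∘ σ = ![(T' ∘ σ) 0, (T' ∘ σ) 1, (T' ∘ σ) 2, fourth ((T' ∘ σ) 0) ((T' ∘ σ) 1) ((T' ∘ σ) 2)] := by
    funext i
    fin_cases i
    · rfl
    · rfl
    · rfl
    · exact hU3
  have hU0 : (T' ∘ σ) 0 ∈ bases := by
    show T' (σ 0) ∈ bases
    rw [hσ0]
    exact hgh
  have hrow := htab _ hU0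
  unfold quadRow at hrow
  simp only [List.all_eq_true] at hrow
  -- the third corner is one of the enumerated ones
  have hU2 := hUsum.two_eq hc hUcm
  have hS : (T' ∘ σ) 2 ∩ ((T' ∘ σ) 0 \ (T' ∘ σ) 1) ∈ ((T' ∘ σ) 0 \ (T' ∘ σ) 1).powerset :=
    Finset.mem_powerset.2 Finset.inter_subset_right
  have hchk := msetAll_eq_true (hrow _ (hall _ (hUcm 1))) _ hS
  rw [← hU2] at hchk
  unfold quadCheckP at hchk
  have key3 : key ((T' ∘ σ) 2) ≤ key (fourth ((T' ∘ σ) 0) ((T' ∘ σ) 1) ((T' ∘ σ) 2)) := by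
    rw [← hU3]
    exact hk23
  have hcond : key ((T' ∘ σ) 1) ≤ key ((T' ∘ σ) 2) ∧
      key ((T' ∘ σ) 2) ≤ key (fourth ((T' ∘ σ) 0) ((T' ∘ σ) 1) ((T' ∘ σ) 2)) ∧
      Intersecting ![(T' ∘ σ) 0, (T' ∘ σ) 1, (T' ∘ σ) 2, fourth ((T' ∘ σ) 0) ((T' ∘ σ) 1) ((T' ∘ σ) 2)] :=
    ⟨hk12, key3, hUeq ▸ hUconj.intersecting hc hUcm⟩
  rw [decide_eq_true hcond, Bool.not_true, Bool.false_or] at hchk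
  show P (T' ∘ σ) = true
  rw [hUeq]
  exact hchk

/-- **From the table with `night4QuadPred` to every conjugate-free `SumTwo` quadruple**: `redDim T ∈ vals`, and the
degree-6 shape whenever `redDim T < 9` (the normal form has the same `redDim` — `redDim_comp_perm`, `redDim_rmul`,
`redDim_smul` — and the same shape). -/
theorem night4Quad_of_table {c : G} (hc : IsComplexConj c) (bases types : List (Finset G))
    (hb : ∀ Φ : Finset G, IsCMType c Φ → ∃ g h : G, rmul (g • Φ) h ∈ bases)
    (hall : ∀ Φ : Finset G, IsCMType c Φ → Φ ∈ types) (key : Finset G → ℕ) (vals : List ℕ)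
    (htab : quadTableP c key (night4QuadPred vals) bases types = true)
    (T : Fin 4 → Finset G) (hT : ∀ i, IsCMType c (T i)) (hsum : SumTwo T) (hconj : ConjFree c T) :
    redDim T ∈ vals ∧ (redDim T < 9 → DegSixShape T) := by
  obtain ⟨g, h, σ, hP⟩ := exists_normalForm_of_quadTableP hc bases types hb hall key _ htab T hT hsum hconj
  unfold night4QuadPred at hP
  rw [decide_eq_true_eq] at hP
  have e1 : redDimFirst (fun i => rmul (g • T (σ i)) h) = redDim T := by
    rw [← redDim_eq_redDimFirst]
    show redDim ((fun i => rmul (g • T i) h) ∘ σ) = redDim T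
    rw [redDim_comp_perm, redDim_rmul, redDim_smul]
  have e2 : DegSixShape (fun i => rmul (g • T (σ i)) h) ↔ DegSixShape T := by
    show DegSixShape ((fun i => rmul (g • T i) h) ∘ σ) ↔ DegSixShape T
    rw [degSixShape_comp_perm_iff, degSixShape_rmul_iff, degSixShape_smul_iff]
  rw [e1, e2] at hP
  exact hP

end Table

end HodgeRepro
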